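import Literature.Combinatorics.Additive.BalogSzemerediGowers
import Literature.Combinatorics.Additive.BalogSzemerediGowersProofs
import Mathlib.Combinatorics.Additive.PluenneckeRuzsa
import Mathlib.Analysis.Real.Sqrt
import Mathlib.Analysis.SpecialFunctions.Pow.Real
import HarnessLib

/-!
# The Balog–Szemerédi–Gowers theorem in the shape consumed by route `QuantumAdvantage/AreaUncertainty`

Topic `Literature/Combinatorics/Additive`; cite/fact item wi-19848 (support item `BoundedAreaCore`,
stmt-QuantumAdvantage-9609, whose SECOND inline hypothesis is, literally, the proposition

  `∃ C₁ : ℕ, ∀ G [AddCommGroup G] [Fintype G] [DecidableEq G] (A : Finset G) (K : ℝ), 1 ≤ K →`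
  `A.Nonempty → |A|³ ≤ K·E(A,A) → ∃ A' ⊆ A, |A| ≤ C₁K^{C₁}|A'| ∧ |(A'×A').image (+)| ≤ C₁K^{C₁}|A'|`).

This is the Fintype-`G`, `ℕ`-constant SPECIALISATION of the symmetric Balog–Szemerédi–Gowers theorem
with polynomial bounds (Zhao 2023, Thm. 7.13.6; Tao–Vu 2006, Thm. 2.31 / Thm. 2.29 + Lemma 2.30),
hence WEAKER than the printed theorem, which the tree already vendors as the named fact
`Zhao2023_thm7136` (`BalogSzemerediGowers.lean`: arbitrary abelian group, one real constant `C > 0`,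
`|A| ≤ C K^C |A'|`, `|A' + A'| ≤ C K^C |A'|`). Accordingly NO new named fact is introduced here
(net debt `0`); the route-shaped proposition is PROVED twice, as an explicit conclusion:

* `bsg_natConst_of_Zhao2023_thm7136` — from `Zhao2023_thm7136`: take `C₁ = ⌈C⌉₊`, since
  `C K^C ≤ ⌈C⌉₊ K^{⌈C⌉₊}` for `K ≥ 1` (`Real.rpow_le_rpow_of_exponent_le`, `Real.rpow_natCast`), and
  `Finset.image_add_product` identifies the image spelling of the sumset with `A' + A'`.
* `bsg_natConst_of_balogSzemerediGowers` — from the two Tao–Vu named facts `balogSzemerediGowers`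
  (Thm. 2.29 as printed) and `energy_partialSumset` (Lemma 2.30): Zhao's "Proof that Theorem 7.13.7
  implies Theorem 7.13.6" — apply both with `A = B` (`K ↦ 2K`, `K' = 2K`) to get `A', B' ⊆ A` with
  `|A'| ≥ |A|/(8√2 K)`, `|B'| ≥ |A|/(8K)`, `|A' + B'| ≤ 2²⁰K⁸|A|`, then Ruzsa's triangle inequality
  `|A' + A'| |B'| ≤ |A' + B'|²` (Mathlib `Finset.ruzsa_triangle_inequality_add_add_add`; Zhao
  Cor. 7.3.6) gives `|A' + A'| ≤ 2⁴³K¹⁷|A| ≤ 2⁴⁷K¹⁸|A'|`; constant `C₁ = 2⁴⁷`.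

So the route item can be restated with `(h : Zhao2023_thm7136) →` (or with the two Tao–Vu facts)
in place of the inline hypothesis, feeding it `bsg_natConst_of_Zhao2023_thm7136 h`.

* `bsg_natConst` — the same proposition UNCONDITIONALLY, now that `Zhao2023_thm7136` is
  discharged in the tree (`Zhao2023_thm7136_holds`, `BalogSzemerediGowersProofs.lean`): the route's
  inline hypothesis can simply be fed `bsg_natConst`.

## References

* Y. Zhao, *Graph Theory and Additive Combinatorics*, CUP (2023): Def. 7.13.1, Thm. 7.13.6, Thm. 7.13.7
  and "Proof that Theorem 7.13.7 implies Theorem 7.13.6", Cor. 7.3.6 (pp. 257–258 of the held copy).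
  [Zhao2023]
* T. Tao, V. Vu, *Additive Combinatorics*, CUP (2006): Def. 2.8, Thm. 2.29, Lemma 2.30, Thm. 2.31
  (§2.3–2.5). [TaoVu2006]
-/

namespace Literature.Combinatorics.Additive

open Finset
open scoped Pointwise

/-- **The route-shaped (Fintype `G`, natural constant) specialisation of Zhao 2023, Thm. 7.13.6**,
from the named fact `Zhao2023_thm7136`: `C₁ = ⌈C⌉₊` works since `C K^C ≤ ⌈C⌉₊ K^{⌈C⌉₊}` for
`K ≥ 1`. Weaker than the printed theorem (finite ambient group, `C₁ ∈ ℕ`); the conclusion is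
literally the second hypothesis of `…AreaUncertainty.BoundedAreaCore`. [cite: Zhao2023, Thm. 7.13.6] -/
theorem bsg_natConst_of_Zhao2023_thm7136 (h : Zhao2023_thm7136) :
    ∃ C₁ : ℕ, ∀ (G : Type) [AddCommGroup G] [Fintype G] [DecidableEq G] (A : Finset G) (K : ℝ),
      1 ≤ K → A.Nonempty → ((A.card : ℝ) ^ 3 ≤ K * Finset.addEnergy A A) →
        ∃ A' : Finset G, A' ⊆ A ∧ (A.card : ℝ) ≤ C₁ * K ^ C₁ * A'.card ∧
          ((((A' ×ˢ A').image fun p => p.1 + p.2).card : ℝ) ≤ C₁ * K ^ C₁ * A'.card) := by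
  obtain ⟨C, hC, h⟩ := h
  refine ⟨⌈C⌉₊, fun G _ _ _ A K hK hA hE ↦ ?_⟩
  have hK0 : 0 < K := by linarith
  have hE' : (A.card : ℝ) ^ 3 / K ≤ Finset.addEnergy A A := by
    rw [div_le_iff₀ hK0]
    linarith [hE]
  obtain ⟨A', hA'A, h1, h2⟩ := h G A K hA hK hE'
  have hcoef : C * K ^ C ≤ (⌈C⌉₊ : ℝ) * K ^ (⌈C⌉₊ : ℕ) := by
    have hle : C ≤ (⌈C⌉₊ : ℝ) := Nat.le_ceil C
    have hKC : K ^ C ≤ K ^ ((⌈C⌉₊ : ℕ) : ℝ) := Real.rpow_le_rpow_of_exponent_le hK hle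
    rw [Real.rpow_natCast] at hKC
    have h0 : 0 ≤ K ^ C := Real.rpow_nonneg hK0.le C
    calc C * K ^ C ≤ (⌈C⌉₊ : ℝ) * K ^ C := by gcongr
      _ ≤ (⌈C⌉₊ : ℝ) * K ^ (⌈C⌉₊ : ℕ) := by gcongr
  refine ⟨A', hA'A, ?_, ?_⟩
  · calc (A.card : ℝ) ≤ C * K ^ C * A'.card := h1
      _ ≤ (⌈C⌉₊ : ℝ) * K ^ (⌈C⌉₊ : ℕ) * A'.card :=
          mul_le_mul_of_nonneg_right hcoef (Nat.cast_nonneg _)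
  · rw [Finset.image_add_product]
    calc ((A' + A').card : ℝ) ≤ C * K ^ C * A'.card := h2
      _ ≤ (⌈C⌉₊ : ℝ) * K ^ (⌈C⌉₊ : ℕ) * A'.card :=
          mul_le_mul_of_nonneg_right hcoef (Nat.cast_nonneg _)

/-- `8 √2 K ≤ 2⁴⁷ K^(2⁴⁷)` for `K ≥ 1` (the bookkeeping of the absolute constant). [folklore] -/
theorem eight_sqrt_two_mul_le (K : ℝ) (hK : 1 ≤ K) :
    8 * Real.sqrt 2 * K ≤ (2 : ℝ) ^ 47 * K ^ (2 ^ 47 : ℕ) := by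
  have h2 : Real.sqrt 2 ≤ 2 := by
    rw [Real.sqrt_le_left (by norm_num : (0 : ℝ) ≤ 2)]
    norm_num
  have hKpow : K ≤ K ^ (2 ^ 47 : ℕ) := le_self_pow₀ hK (by norm_num)
  have hK0 : 0 ≤ K := by linarith
  calc 8 * Real.sqrt 2 * K ≤ 8 * 2 * K := by gcongr
    _ ≤ (2 : ℝ) ^ 47 * K := by nlinarith
    _ ≤ (2 : ℝ) ^ 47 * K ^ (2 ^ 47 : ℕ) := by gcongr

/-- `2⁴⁷ K¹⁸ ≤ 2⁴⁷ K^(2⁴⁷)` for `K ≥ 1`. [folklore] -/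
theorem pow_eighteen_le (K : ℝ) (hK : 1 ≤ K) :
    (2 : ℝ) ^ 47 * K ^ 18 ≤ (2 : ℝ) ^ 47 * K ^ (2 ^ 47 : ℕ) :=
  mul_le_mul_of_nonneg_left (pow_le_pow_right₀ hK (by norm_num)) (by positivity)

/-- **The same route-shaped proposition from Tao–Vu Thm. 2.29 and Lemma 2.30** (the tree's named
facts `balogSzemerediGowers`, `energy_partialSumset`), by Zhao's derivation of Thm. 7.13.6 from
Thm. 7.13.7: apply both with `A = B`, then Ruzsa's triangle inequality
`|A' + A'| · |B'| ≤ |A' + B'| · |B' + A'|`; constant `C₁ = 2⁴⁷`. The conclusion is the Fintype-`G`,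
`ℕ`-constant specialisation of the printed symmetric theorem (weaker than Zhao 7.13.6 / Tao–Vu 2.31
as printed). [cite: Zhao2023, §7.13 (proof that Thm. 7.13.7 implies Thm. 7.13.6)] -/
theorem bsg_natConst_of_balogSzemerediGowers (h₁ : balogSzemerediGowers)
    (h₂ : energy_partialSumset) :
    ∃ C₁ : ℕ, ∀ (G : Type) [AddCommGroup G] [Fintype G] [DecidableEq G] (A : Finset G) (K : ℝ),
      1 ≤ K → A.Nonempty → ((A.card : ℝ) ^ 3 ≤ K * Finset.addEnergy A A) →
        ∃ A' : Finset G, A' ⊆ A ∧ (A.card : ℝ) ≤ C₁ * K ^ C₁ * A'.card ∧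
          ((((A' ×ˢ A').image fun p => p.1 + p.2).card : ℝ) ≤ C₁ * K ^ C₁ * A'.card) := by
  refine ⟨2 ^ 47, fun G _ _ _ A K hK hA hE ↦ ?_⟩
  have hK0 : 0 < K := by linarith
  have ha0 : (0 : ℝ) < A.card := by exact_mod_cast hA.card_pos
  have hsq : Real.sqrt ((A.card : ℝ) * A.card) = A.card := Real.sqrt_mul_self ha0.le
  -- Lemma 2.30: a dense `G ⊆ A × A` with small partial sumset
  have hE' : Real.sqrt ((A.card : ℝ) * A.card) ^ 3 / K ≤ Finset.addEnergy A A := by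
    rw [hsq, div_le_iff₀ hK0]
    linarith [hE]
  obtain ⟨Gr, hGsub, hGcard, hGsum⟩ := h₂ G A A K hA hA hK hE'
  -- Theorem 2.29 with `K ↦ 2K`, `K' = 2K`
  have h2K : (1 : ℝ) ≤ 2 * K := by linarith
  have h2K0 : (0 : ℝ) < 2 * K := by linarith
  obtain ⟨A', hA'A, B', -, hA', hB', hsum⟩ :=
    h₁ G A A Gr (2 * K) (2 * K) hA hA h2K h2K0 hGsub hGcard hGsum
  rw [hsq] at hsum
  -- unpack the bounds
  have hden : (0 : ℝ) < 4 * Real.sqrt 2 * (2 * K) := by positivity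
  have hA'low : (A.card : ℝ) ≤ 8 * Real.sqrt 2 * K * A'.card := by
    have h := (div_le_iff₀ hden).1 hA'
    calc (A.card : ℝ) ≤ A'.card * (4 * Real.sqrt 2 * (2 * K)) := h
      _ = 8 * Real.sqrt 2 * K * A'.card := by ring
  have hB'low : (A.card : ℝ) ≤ 8 * K * B'.card := by
    have h := (div_le_iff₀ (by positivity : (0 : ℝ) < 4 * (2 * K))).1 hB'
    calc (A.card : ℝ) ≤ B'.card * (4 * (2 * K)) := h
      _ = 8 * K * B'.card := by ring
  have hb0 : (0 : ℝ) < B'.card :=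
    pos_of_mul_pos_right (ha0.trans_le hB'low) (by positivity)
  have hsum' : ((A' + B').card : ℝ) ≤ 2 ^ 20 * K ^ 8 * A.card := by
    have : (2 : ℝ) ^ 12 * (2 * K) ^ 5 * (2 * K) ^ 3 * A.card = 2 ^ 20 * K ^ 8 * A.card := by ring
    linarith [hsum, this]
  -- Ruzsa's triangle inequality
  have hR : ((A' + A').card : ℝ) * B'.card ≤ (A' + B').card * (A' + B').card := by
    have := Finset.ruzsa_triangle_inequality_add_add_add A' B' A'
    rw [add_comm B' A'] at this
    exact_mod_cast this
  -- the doubling of `A'`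
  have hAA : ((A' + A').card : ℝ) ≤ 2 ^ 47 * K ^ 18 * A'.card := by
    -- |A'+A'| · |B'| ≤ (2²⁰K⁸|A|)², |A| ≤ 8K|B'|  ⇒  |A'+A'| ≤ 2⁴³ K¹⁷ |A| ≤ 2⁴⁷ K¹⁸ |A'|
    have h1 : ((A' + A').card : ℝ) * B'.card ≤ (2 ^ 20 * K ^ 8 * A.card) ^ 2 := by
      calc ((A' + A').card : ℝ) * B'.card ≤ (A' + B').card * (A' + B').card := hR
        _ ≤ (2 ^ 20 * K ^ 8 * A.card) * (2 ^ 20 * K ^ 8 * A.card) := by gcongr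
        _ = (2 ^ 20 * K ^ 8 * A.card) ^ 2 := by ring
    have h2 : ((A' + A').card : ℝ) * A.card ≤ (2 ^ 20 * K ^ 8 * A.card) ^ 2 * (8 * K) := by
      calc ((A' + A').card : ℝ) * A.card ≤ (A' + A').card * (8 * K * B'.card) := by
            gcongr
        _ = ((A' + A').card * B'.card) * (8 * K) := by ring
        _ ≤ (2 ^ 20 * K ^ 8 * A.card) ^ 2 * (8 * K) := by gcongr
    have h3 : ((A' + A').card : ℝ) ≤ 2 ^ 43 * K ^ 17 * A.card := by
      have h2' : ((A' + A').card : ℝ) * A.card ≤ (2 ^ 43 * K ^ 17 * A.card) * A.card := by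
        have : (2 ^ 20 * K ^ 8 * (A.card : ℝ)) ^ 2 * (8 * K) = (2 ^ 43 * K ^ 17 * A.card) * A.card := by
          ring
        linarith [h2, this]
      exact le_of_mul_le_mul_right h2' ha0
    have h2le : Real.sqrt 2 ≤ 2 := by
      rw [Real.sqrt_le_left (by norm_num : (0 : ℝ) ≤ 2)]
      norm_num
    calc ((A' + A').card : ℝ) ≤ 2 ^ 43 * K ^ 17 * A.card := h3
      _ ≤ 2 ^ 43 * K ^ 17 * (8 * Real.sqrt 2 * K * A'.card) := by gcongr
      _ = 2 ^ 46 * K ^ 18 * (Real.sqrt 2 * A'.card) := by ring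
      _ ≤ 2 ^ 46 * K ^ 18 * (2 * A'.card) := by gcongr
      _ = 2 ^ 47 * K ^ 18 * A'.card := by ring
  refine ⟨A', hA'A, ?_, ?_⟩
  · -- |A| ≤ 8√2 K |A'| ≤ 2⁴⁷ K^(2⁴⁷) |A'|
    calc (A.card : ℝ) ≤ 8 * Real.sqrt 2 * K * A'.card := hA'low
      _ ≤ (2 : ℝ) ^ 47 * K ^ (2 ^ 47 : ℕ) * A'.card := by
          gcongr ?_ * _
          exact eight_sqrt_two_mul_le K hK
      _ = ((2 ^ 47 : ℕ) : ℝ) * K ^ (2 ^ 47 : ℕ) * A'.card := by push_cast; ring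
  · rw [Finset.image_add_product]
    calc ((A' + A').card : ℝ) ≤ 2 ^ 47 * K ^ 18 * A'.card := hAA
      _ ≤ (2 : ℝ) ^ 47 * K ^ (2 ^ 47 : ℕ) * A'.card := by
          gcongr ?_ * _
          exact pow_eighteen_le K hK
      _ = ((2 ^ 47 : ℕ) : ℝ) * K ^ (2 ^ 47 : ℕ) * A'.card := by push_cast; ring

/-- **The route-shaped Balog–Szemerédi–Gowers proposition, unconditionally**: there is `C₁ : ℕ`
such that for every finite abelian group `G`, every nonempty `A ⊆ G` and `K ≥ 1` with
`|A|³ ≤ K · E(A, A)` there is `A' ⊆ A` with `|A| ≤ C₁ K^{C₁} |A'|` and `|A' + A'| ≤ C₁ K^{C₁} |A'|`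
(sumset spelled as the image of `A' ×ˢ A'` under `+`, literally the second inline hypothesis of the
route item `BoundedAreaCore`). Immediate from `bsg_natConst_of_Zhao2023_thm7136` and the tree's
discharge `Zhao2023_thm7136_holds` of Zhao 2023, Thm. 7.13.6 (whose absolute constant is `2 ^ 28`,
so `C₁ = 2 ^ 28` works, though only existence is asserted here). [cite: Zhao2023, Thm. 7.13.6] -/
theorem bsg_natConst :
    ∃ C₁ : ℕ, ∀ (G : Type) [AddCommGroup G] [Fintype G] [DecidableEq G] (A : Finset G) (K : ℝ),
      1 ≤ K → A.Nonempty → ((A.card : ℝ) ^ 3 ≤ K * Finset.addEnergy A A) →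
        ∃ A' : Finset G, A' ⊆ A ∧ (A.card : ℝ) ≤ C₁ * K ^ C₁ * A'.card ∧
          ((((A' ×ˢ A').image fun p => p.1 + p.2).card : ℝ) ≤ C₁ * K ^ C₁ * A'.card) :=
  bsg_natConst_of_Zhao2023_thm7136 Zhao2023_thm7136_holds

end Literature.Combinatorics.Additive
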